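import Literature.Probability.Percolation.HorizontalTransportBound
import Literature.Probability.Percolation.StripDictionary
import HarnessLib

/-!
# Transport of horizontal crossings (GM14 Proposition 6.4) — IV: back to `G_{α,β}`

The previous files of this line work on the strip model `TrackExchangeStrip` (labels
`SV = Option (ℤ × ℤ)`, weights `canonicalWeight`). This file transports the conclusion
`HData.horizontal_transport_strip` to the tree's isoradial square lattice
`Literature.Probability.Percolation.IsoradialSquareLatticeGM` — the abstract `ℤ²` (`Site 2`,
`zdGraph 2`) with the product measure `prodBernoulli (gmWeight α rows)` (`= (gmEmbedding α rows)
.isoradialPercolation`, `isoradialPercolation_gmEmbedding`), GM14's `P_{α,β}` — along the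
dictionary `gmLabel : x ↦ v_{x₀-x₁, x₀+x₁}` (`canonicalWeight_map_gmLabel`):

* `toStrip M ω` — the configuration of the strip read off a configuration of `ℤ²` (the images
  of the open edges of the columns `-M ≤ i < M`); **`map_toStrip`**: its law under
  `P_{α,rows}` is the strip measure `prodBernoulli (canonicalWeight M (rows - α))`
  (thinning of a product measure along an injection, `prodBernoulli_map_thin`, and the support of
  `canonicalWeight`);
* `initEventGM ρ N` (GM14's `E_N`: an `ω`-open path of `ℤ²`, in diamond coordinates
  `(i, y) = (x₀ - x₁, x₀ + x₁)` inside `B(ρN, N)`, from height `0` at `i ∈ [-ρN, -(ρ-1)N]` to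
  height `0` at `i ∈ [(ρ-1)N, ρN]`) and `finalEventGM ρ N K` (such a path with all heights in
  `[0, K]`: a horizontal crossing of `B((ρ-1)N, K)`), with `initEventGM ⊆ toStrip ⁻¹' initEvent`
  and `toStrip ⁻¹' finalEvent ⊆ finalEventGM`;
* **`HData.horizontal_transport_gm`** — GM14 Proposition 6.4 in diamond coordinates with `E_N`
  in place of its FKG lower bound (6.12): for `0 < ε ≤ π/2` there are `λ, N₀ ≥ 1` such that for
  `ρ ≥ 1`, `N ≥ N₀` and valid data (`K = λN`, wide strip),
  `(1 - ρe^{-N}) · P_{α,β̃}(E_N) ≤ P_{α,rows K}(finalEventGM ρ N K)`, where `β̃ = rowAngle 0`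
  (regular angle `ξ` on the levels `< N`, then `β_0, β_1, …`) and `rowAngle K` carries
  `β_0, …, β_{K-1}` on the levels `< K` — the rows used by `finalEventGM`.

## References

* G. R. Grimmett, I. Manolescu, PTRF 159 (2014) 273–327, arXiv:1204.0505, §4.6 (`G_{α,β}`,
  `P_{α,β}`), §6.2 Proposition 6.4.
-/

noncomputable section

namespace Literature.Probability.Percolation

open LatticeModels StarTriangle Real MeasureTheory GrowthProcess

namespace TrackExchange

/-! ### The events of Proposition 6.4 read off the strip -/

/-- **`E_N` reads off as the strip's `initEvent`** (when the box fits in the strip). [cite: GrimmettManolescu2014Isoradial, §6.2] -/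
theorem initEventGM_subset_preimage {M ρ N : ℕ} (hM : ((ρ * N : ℕ) : ℤ) < M) :
    initEventGM ρ N ⊆ toStrip M ⁻¹' HData.initEvent ρ N := by
  rintro ω ⟨L, hL, ⟨a, ha, ha0, ha1, ha2⟩, ⟨b, hb, hb0, hb1, hb2⟩, hbox⟩
  refine ⟨L.map gmLabel, ⟨⟨col a, ?_, ha1, ha2⟩, ⟨col b, ?_, hb1, hb2⟩, ?_, ?_⟩, ?_⟩
  · rw [List.head?_map, ha, Option.map_some, gmLabel_eq, ha0]
  · rw [List.getLast?_map, hb, Option.map_some, gmLabel_eq, hb0]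
  · rw [List.mem_map]; rintro ⟨x, -, hx⟩; simp [gmLabel] at hx
  · intro m y hm
    rw [List.mem_map] at hm
    obtain ⟨x, hx, hxl⟩ := hm
    simp only [gmLabel_eq, Option.some.injEq, Prod.mk.injEq] at hxl
    obtain ⟨rfl, rfl⟩ := hxl
    have h := hbox x hx
    exact ⟨h.1, h.2.1, h.2.2, ⟨x 0, by simp only [col, hgtOf]; ring⟩⟩
  · refine isWalk_map_gmLabel hL fun x hx => ?_
    have h := (hbox x hx).1
    rw [abs_le] at h
    constructor <;> omega

/-- **The strip's target event reads off as the target event on `ℤ²`.** [cite: GrimmettManolescu2014Isoradial, §6.2 (6.14)] -/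
theorem preimage_finalEvent_subset (H : HData) (ρ N : ℕ) :
    toStrip H.M ⁻¹' H.finalEvent ρ N ⊆ finalEventGM ρ N H.K := by
  rintro ω ⟨W, hW, ⟨x₀, hh, hx₀, hx₀'⟩, ⟨x₁, hl, hx₁, hx₁'⟩, hn, hlab⟩
  -- all labels are primal (a one-vertex walk is `v_{0,0}`)
  have hpar : ∀ m y, some (m, y) ∈ W → Even (m + y) := by
    intro m y hm
    rcases Nat.lt_or_ge W.length 2 with hlen | hlen
    · -- `W = [some (x₀, 0)]` with `x₀ = 0`
      rcases W with _ | ⟨u, _ | ⟨v, l⟩⟩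
      · simp at hm
      · simp only [List.head?_cons, Option.some.injEq] at hh
        simp only [List.getLast?_singleton, Option.some.injEq] at hl
        subst hh
        simp only [Option.some.injEq, Prod.mk.injEq] at hl
        simp only [List.mem_singleton, Option.some.injEq, Prod.mk.injEq] at hm
        obtain ⟨rfl, rfl⟩ := hm
        exact ⟨0, by omega⟩
      · simp at hlen
    · exact even_of_mem_of_isWalk hW hn hlen m y hm
  refine ⟨W.map siteOf, isLatticeWalk_map_siteOf hW hn, ?_, ?_, fun x hx => ?_⟩
  · have h0 := hpar x₀ 0 (List.mem_of_mem_head? (by rw [hh]; rfl))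
    refine ⟨unlabelSite (x₀, 0), by rw [List.head?_map, hh]; rfl, ?_⟩
    have h := col_hgtOf_unlabelSite h0
    rw [h.1, h.2]; exact ⟨rfl, hx₀, hx₀'⟩
  · have h0 := hpar x₁ 0 (List.mem_of_getLast? hl)
    refine ⟨unlabelSite (x₁, 0), by rw [List.getLast?_map, hl]; rfl, ?_⟩
    have h := col_hgtOf_unlabelSite h0
    rw [h.1, h.2]; exact ⟨rfl, hx₁, hx₁'⟩
  · rw [List.mem_map] at hx
    obtain ⟨z, hz, rfl⟩ := hx
    rcases z with _ | ⟨m, y⟩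
    · exact absurd hz hn
    have h := col_hgtOf_unlabelSite (hpar m y hz)
    simp only [siteOf]
    rw [h.2]
    exact hlab m y hz

/-! ### Proposition 6.4 on `ℤ²` -/

/-- **Transport of horizontal crossings through the regular block** (GM14 Proposition 6.4 in
diamond coordinates, with `E_N` in place of its FKG lower bound (6.12)): for `0 < ε ≤ π/2` there
are `λ, N₀ ≥ 1`, depending on `ε` only, such that for all `ρ ≥ 1`, `N ≥ N₀` and all valid data
`H` (`BAC(ε)` for `ξ` and every `β_k`, `K = λN`, `M ≥ (ρ+1)N + 2λN + 3`):
`(1 - ρe^{-N}) · P_{α,β̃}(E_N) ≤ P_{α,rows K}(finalEventGM ρ N K)` with `β̃ = H.rowAngle 0` and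
`rows K = H.rowAngle K` (levels `< K` carrying `β_0, …, β_{K-1}`). [cite: GrimmettManolescu2014Isoradial, §6.2 Proposition 6.4] -/
theorem HData.horizontal_transport_gm {ε : ℝ} (hε : 0 < ε) (hε' : ε ≤ π / 2) :
    ∃ lam N₀ : ℕ, 1 ≤ lam ∧ ∀ (ρ N : ℕ), 1 ≤ ρ → N₀ ≤ N → ∀ (H : HData), H.Valid ε → H.K = lam * N →
      (((ρ + 1) * N : ℕ) : ℤ) + 2 * (lam * N : ℕ) + 3 ≤ H.M →
      ENNReal.ofReal (1 - ρ * Real.exp (-N)) *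
          prodBernoulli (Percolation.gmWeight H.α (H.rowAngle 0)) (initEventGM ρ N) ≤
        prodBernoulli (Percolation.gmWeight H.α (H.rowAngle H.K)) (finalEventGM ρ N H.K) := by
  obtain ⟨lam, N₀, hlam, h⟩ := HData.horizontal_transport_strip hε hε'
  refine ⟨lam, N₀, hlam, fun ρ N hρ hN H hH hK hM => ?_⟩
  have hstrip := h ρ N hρ hN H hH hK hM
  have hM' : ((ρ * N : ℕ) : ℤ) < H.M := by push_cast at hM ⊢; nlinarith
  -- the two measures on the strip are read off `ℤ²`
  have h0 : prodBernoulli (H.weights 0) = (prodBernoulli (Percolation.gmWeight H.α (H.rowAngle 0))).map (toStrip H.M) :=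
    (map_toStrip H.M H.α (H.rowAngle 0)).symm
  have hK' : prodBernoulli (H.weights H.K) = (prodBernoulli (Percolation.gmWeight H.α (H.rowAngle H.K))).map (toStrip H.M) :=
    (map_toStrip H.M H.α (H.rowAngle H.K)).symm
  rw [h0, hK', Measure.map_apply (measurable_toStrip _) (HData.measurableSet_initEvent ρ N),
    Measure.map_apply (measurable_toStrip _) (H.measurableSet_finalEvent ρ N)] at hstrip
  calc ENNReal.ofReal (1 - ρ * Real.exp (-N)) * prodBernoulli (Percolation.gmWeight H.α (H.rowAngle 0)) (initEventGM ρ N)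
      ≤ ENNReal.ofReal (1 - ρ * Real.exp (-N)) *
          prodBernoulli (Percolation.gmWeight H.α (H.rowAngle 0)) (toStrip H.M ⁻¹' HData.initEvent ρ N) :=
        mul_le_mul' le_rfl (measure_mono (initEventGM_subset_preimage hM'))
    _ ≤ prodBernoulli (Percolation.gmWeight H.α (H.rowAngle H.K)) (toStrip H.M ⁻¹' H.finalEvent ρ N) := hstrip
    _ ≤ prodBernoulli (Percolation.gmWeight H.α (H.rowAngle H.K)) (finalEventGM ρ N H.K) :=
        measure_mono (preimage_finalEvent_subset H ρ N)

end TrackExchange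

end Literature.Probability.Percolation
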